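import Mathlib
import HarnessLib

/-!
# Markman 2025 — LEMMA 3.1.3 (the discriminant of the Hermitian form of `X × X̂` is `(−1)ⁿ`):
# the arithmetic of its proof AS PRINTED (v2 p. 23 L46 – p. 24 L40), kernel-checked

E. Markman: [M] *Cycles on abelian 2n-folds of Weil type from secant sheaves on abelian n-folds*,
arXiv:2502.03415 **v2** (2025-06-08), bib `Markman2025SecantWeil` — UNREFEREED PREPRINT; [S] *Secant sheaves and Weil
classes on abelian varieties*, arXiv:2509.23403 **v2** (2026-02-11), bib `Markman2025SurveySecant` (survey). «v2 p. N L m» = PyMuPDF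
line `m` of PDF page `N` of the public arXiv PDF (sha256/16 `8155aa33870069b8`); statement and proof read BY EYE at
seat lit-w-markman (pub-hsemireg LIT-W, 2026-08-23; renders `r_mar25v2_p23_lemma313.png`, `r_mar25v2_p24_top.png`).

## What is printed (verbatim)

* LEMMA 3.1.3 (v2 p. 23 L46–48): «Assume that the similarity `f : V_ℚ → V_ℚ` given in Equation (2.4.1) is defined in
  terms of the oriented plane `P` given in Equation (2.4.5). Then the discriminant of the hermitian form `H` is
  `(−1)ⁿ`.»  (`H` = the `K`-valued Hermitian form (3.1.2) on `V_ℚ = H¹(X, ℚ) ⊕ H¹(X̂, ℚ)`, `K = ℚ(√−d)`, signature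
  `(n, n)` by LEMMA 3.1.2, p. 23 L3–6; used at the proof of THEOREM 1.5.1, v2 p. 88 L28–29: «The discriminant of the
  Hermitian form is `−1`, by Lemma 3.1.3.» — i.e. `X × X̂` with `n = 3` is of SPLIT Weil type, discriminant
  `(−1)³ = −1`.)
* PROOF (v2 p. 23 L49 – p. 24 L40, by eye): «Given a basis `{y₁, …, y_{2n}}` of `H¹(X̂, ℚ)` we get the `K`-basis
  `{(0, y₁), …, (0, y_{2n})}` of `V_ℚ`. We evaluate `det(H((0, y_i), (0, y_j)))`. Given `y ∈ H¹(X̂, ℚ)`, we get the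
  element `exp(u) · (0, y) = (−√−dθ(y), y)` of `W₁`, by Equation (2.4.4). We get
  `(0, y) = (1/2)[exp(u) · (0, y) + \overline{exp(u)} · (0, y)]`,
  `2f(0, y) = √−d exp(u) · (0, y) + (−√−d)\overline{exp(u)} · (0, y) = √−d(−√−dθ(y), y) − √−d(√−dθ(y), y) = (2dθ(y), 0)`,
  `H((0, y_i), (0, y_j)) = d((0, y_i), (0, y_j))_V + √−d(f(0, y_i), (0, y_j)) = d√−dΘ(y_i, y_j)`,
  `det(H(((0, y_i), (0, y_j))) = (d√−d)^{2n} det(Θ(y_i, y_j)) = (−1)ⁿd^{3n} det(Θ(y_i, y_j))`.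
  Now, `det(Θ(y_i, y_j))` is the square of a rational number, since `Θ` is anti-symmetric, and
  `d^{3n} = Nm((√−d)^{3n})`. Hence, `det(H(((0, y_i), (0, y_j))) Nm(K^×) = (−1)ⁿ Nm(K^×)`.»

## What this file proves (kernel-checked arithmetic of the sentences above; NO named fact; nothing geometric)
With `s` any element of a field with `s² = −d` (playing `√−d`; `σ(s) = −s` its conjugate, so
`Nm(x + ys) = (x + ys)(x − ys)`): (1) the component arithmetic of the `2f(0, y)` display:
`s·(−s·θ) − s·(s·θ) = 2d·θ` and `s·y + (−s)·y = 0`; (2) `det((ds)·Θ) = (ds)^{2n}·det Θ` for ANY `2n × 2n` matrix `Θ`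
(Mathlib `Matrix.det_smul`) and the prefactor `(ds)^{2n} = (−1)ⁿd^{3n}`; (3) «`d^{3n} = Nm((√−d)^{3n})`»:
`s^{3n}·(−s)^{3n} = d^{3n}`; (4) the conclusion modulo norms: if `det Θ = q²` then
`(−1)ⁿd^{3n}q² = (−1)ⁿ·Nm(s^{3n}q)` with `Nm(s^{3n}q) = (s^{3n}q)((−s)^{3n}q)`, a norm of a NON-ZERO element when
`d, q ≠ 0` (so the discriminant class in `ℚ^×/Nm(K^×)` is `(−1)ⁿ`); (5) the `n = 3` value `(−1)³ = −1` behind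
«discriminant −1» for the sixfold `X × X̂`. BY VALUE / NOT formalised: the Hermitian form (3.1.2) itself,
`exp(u) · (0, y) = (−√−dθ(y), y)` (2.4.4), the isotropy `((0, y_i), (0, y_j))_V = 0`,
`(f(0, y_i), (0, y_j))_V = dΘ(y_i, y_j)`, and «`det Θ` is a square since `Θ` is anti-symmetric» (a Pfaffian
statement, taken by value as the hypothesis `det Θ = q²`). Bookkeeping for the pub-hsemireg LIT-W table row M-Mk1
(«split» = `H` has an isotropic subspace of half the dimension, [S] = arXiv:2509.23403v2 p. 2 L41–43; «The
discriminant takes values in `ℚ^×/Nm_{K/ℚ}(K^×)` and is the coset of `(−1)ⁿ` if and only if the component parametrizes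
polarized abelian varieties of split Weil type [DM, Cor. 4.2].», [S] v2 p. 21 L33–35) and scope line (S1); it says
nothing about the Hodge conjecture and re-proves no theorem of [M].  An Appendix at the end of the file (lit-w-markman
g13) adds the three one-line deductions of (2.4.1)–(2.4.2), v2 p. 19 L12–36 (`f` anti-self-dual, `Ξ_P` alternating and
non-degenerate, `Ξ_P(x, y) = √−d((x₁, y₂)_V − (x₂, y₁)_V)`), for a bilinear form and a similarity `f` with `f² = −d`.
-/

namespace Literature.AlgebraicGeometry.Markman2025

namespace ProductDiscriminant

variable {K : Type*} [Field K]

/-- **[M] v2 p. 24 L3–23, the `2f(0, y)` display**: «`2f(0, y) = √−d exp(u)·(0, y) + (−√−d)\overline{exp(u)}·(0, y)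
= √−d(−√−dθ(y), y) − √−d(√−dθ(y), y) = (2dθ(y), 0)`» — componentwise, with `s² = −d`, for the `H¹(X)`-component
`θ` and the `H¹(X̂)`-component `y` (elements of any `K`-vector space): `s•(−(s•θ)) − s•(s•θ) = (2d)•θ` and
`s•y + (−s)•y = 0`. [cite: Markman2025SecantWeil, proof of Lemma 3.1.3, v2 p. 24 L3–23] -/
theorem two_f_components {W : Type*} [AddCommGroup W] [Module K W] (d s : K) (hs : s ^ 2 = -d) (θ y : W) :
    s • (-(s • θ)) - s • (s • θ) = (2 * d) • θ ∧ s • y + (-s) • y = 0 := by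
  constructor
  · have h2 : s * s = -d := by rw [← pow_two, hs]
    rw [smul_neg, smul_smul, h2, neg_smul, neg_neg, sub_neg_eq_add, ← add_smul]
    congr 1
    ring
  · rw [neg_smul, add_neg_cancel]

/-- **[M] v2 p. 24 L31–35** «`det(H(((0, y_i), (0, y_j))) = (d√−d)^{2n} det(Θ(y_i, y_j)) = (−1)ⁿd^{3n} det(Θ(y_i, y_j))`»:
for ANY `2n × 2n` matrix `Θ` over `K` and `s² = −d`, `det((d s)·Θ) = (d s)^{2n} det Θ` (Mathlib `Matrix.det_smul`)
and `(d s)^{2n} = (−1)ⁿ d^{3n}` (the Gram matrix `H((0, y_i), (0, y_j)) = d√−d Θ(y_i, y_j)` of L24–30 enters by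
value). [cite: Markman2025SecantWeil, proof of Lemma 3.1.3, v2 p. 24 L24–35] -/
theorem det_gram (n : ℕ) (d s : K) (hs : s ^ 2 = -d) (Θ : Matrix (Fin (2 * n)) (Fin (2 * n)) K) :
    ((d * s) • Θ).det = (d * s) ^ (2 * n) * Θ.det ∧ (d * s) ^ (2 * n) = (-1) ^ n * d ^ (3 * n) := by
  constructor
  · rw [Matrix.det_smul, Fintype.card_fin]
  · have h : (d * s) ^ 2 = -(d ^ 3) := by rw [mul_pow, hs]; ring
    rw [pow_mul, h, neg_pow, ← pow_mul]

/-- **[M] v2 p. 24 L36–39** «`d^{3n} = Nm((√−d)^{3n})`»: with `σ(√−d) = −√−d`, `Nm(x) = x·σ(x)` and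
`Nm(√−d) = √−d·(−√−d) = d`; multiplicativity gives `(√−d)^{3n}·(−√−d)^{3n} = d^{3n}`.
[cite: Markman2025SecantWeil, proof of Lemma 3.1.3, v2 p. 24 L36–39] -/
theorem norm_sqrt_pow (n : ℕ) (d s : K) (hs : s ^ 2 = -d) :
    s * (-s) = d ∧ s ^ (3 * n) * (-s) ^ (3 * n) = d ^ (3 * n) := by
  have h1 : s * (-s) = d := by rw [mul_neg, ← pow_two, hs, neg_neg]
  exact ⟨h1, by rw [← mul_pow, h1]⟩

/-- **[M] v2 p. 24 L36–40, the conclusion** «Now, `det(Θ(y_i, y_j))` is the square of a rational number, since `Θ`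
is anti-symmetric, and `d^{3n} = Nm((√−d)^{3n})`. Hence, `det(H(((0, y_i), (0, y_j))) Nm(K^×) = (−1)ⁿ Nm(K^×)`.»:
taking «`det Θ = q²`» BY VALUE, the determinant `(−1)ⁿ d^{3n} q²` is `(−1)ⁿ` times the norm
`Nm(s^{3n} q) = (s^{3n} q)·((−s)^{3n} q)` of the NON-ZERO element `s^{3n} q` of `K` (for `d ≠ 0`, `q ≠ 0`), i.e. the
discriminant class in `ℚ^×/Nm(K^×)` is `(−1)ⁿ`; LEMMA 3.1.3.
[cite: Markman2025SecantWeil, Lemma 3.1.3, v2 p. 23 L46–48; proof p. 24 L36–40] -/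
theorem discriminant_class (n : ℕ) (d s q : K) (hs : s ^ 2 = -d) (hd : d ≠ 0) (hq : q ≠ 0) :
    (-1) ^ n * d ^ (3 * n) * q ^ 2 = (-1) ^ n * ((s ^ (3 * n) * q) * ((-s) ^ (3 * n) * q)) ∧
    s ^ (3 * n) * q ≠ 0 := by
  have hs0 : s ≠ 0 := by
    rintro rfl
    apply hd
    have : (0 : K) ^ 2 = -d := hs
    simpa using this.symm
  refine ⟨?_, mul_ne_zero (pow_ne_zero _ hs0) hq⟩
  rw [show (s ^ (3 * n) * q) * ((-s) ^ (3 * n) * q) = (s ^ (3 * n) * (-s) ^ (3 * n)) * q ^ 2 by ring,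
    (norm_sqrt_pow n d s hs).2]
  ring

/-- **[M] v2 p. 88 L28–29 (proof of THEOREM 1.5.1)** «The discriminant of the Hermitian form is `−1`, by Lemma
3.1.3.»: the `n = 3` value `(−1)³ = −1` and the prefactor `(d√−d)⁶ = −d⁹` — the sixfold `X × X̂` is of SPLIT Weil
type (discriminant coset `(−1)ⁿ` ⟺ split, [DM, Cor. 4.2] as cited in [S] v2 p. 21 L33–35; by value).
[cite: Markman2025SecantWeil, §9.3, proof of Theorem 1.5.1 (statement p. 9), v2 p. 88 L28–29]
[cite: Markman2025SurveySecant, §11.5 Step 1, v2 p. 21 L33–35] -/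
theorem discriminant_sixfold (d s : K) (hs : s ^ 2 = -d) :
    ((-1 : K)) ^ 3 = -1 ∧ (d * s) ^ 6 = -(d ^ 9) := by
  refine ⟨by norm_num, ?_⟩
  have h := (det_gram 3 d s hs (0 : Matrix (Fin (2 * 3)) (Fin (2 * 3)) K)).2
  norm_num at h
  exact h

end ProductDiscriminant

/-! ## Appendix (lit-w-markman g13, 2026-08-23): the 2-form `Ξ_P` of (2.4.1)–(2.4.2) AS PRINTED — the three
one-line deductions on v2 p. 19 L12–36, kernel-checked for a symmetric bilinear form and a similarity

AS PRINTED ([M] v2 p. 19 L12–36, read by eye): «Set (2.4.1) `f := η_{√−d} : V_ℚ → V_ℚ`, … Note that `f` belongs to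
`Õ(V_ℚ)`, `(f(x), f(y))_V = d(x, y)_V`, and `f² = −d`, by Lemma 2.2.4. Hence `(f(x), y)_V = (1/d)(f²(x), f(y))_V =
−(x, f(y))_V`, and so `f` is anti-self-dual. Let `Ξ_P ∈ ∧²V^*_ℚ` be the 2-form (2.4.2) `Ξ_P(x, y) := (f(x), y)_V`. The
2-form `Ξ_P` is non-degenerate, since `f` is invertible and the pairing (1.2.2) on `V` is non-degenerate. Note the
equality `Ξ_P(x, y) = √−d((x₁, y₂)_V − (x₂, y₁)_V)`, where `x = x₁ + x₂` is the decomposition with `xᵢ ∈ Wᵢ`,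
`i = 1, 2`, and `y = y₁ + y₂` is the analogous decomposition.»  MODEL: a vector space `V` over a field `K` with a
bilinear form `B` (for `(•, •)_V`), a linear `f` with `B(fx, fy) = d·B(x, y)` and `f(f x) = −d·x`; the `Wᵢ` enter only
through «`f = ±√−d` on `Wᵢ`» and «`Wᵢ` isotropic» as hypotheses on the four vectors (Lemma 2.2.6 ∕ (2.4.6) by value).
Theorems only; nothing about `X`. -/

namespace WeilFormXi

variable {K : Type*} [Field K] {V : Type*} [AddCommGroup V] [Module K V]

/-- **v2 p. 19 L23–27** «`(f(x), y)_V = (1/d)(f²(x), f(y))_V = −(x, f(y))_V`, and so `f` is anti-self-dual»: from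
`B(fx, fy) = d·B(x, y)`, `f² = −d` and `d ≠ 0`. [cite: Markman2025SecantWeil, (2.4.1), v2 p. 19 L12–27 (transcription)] -/
theorem anti_self_dual (B : V →ₗ[K] V →ₗ[K] K) (f : V →ₗ[K] V) (d : K) (hd : d ≠ 0)
    (hf : ∀ x y, B (f x) (f y) = d * B x y) (hff : ∀ x, f (f x) = -(d • x)) (x y : V) :
    B (f x) y = -B x (f y) := by
  have h := hf (f x) y
  rw [hff, map_neg, map_smul, LinearMap.neg_apply, LinearMap.smul_apply, smul_eq_mul] at h
  -- h : -(d * B x (f y)) = d * B (f x) y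
  have : d * (B (f x) y + B x (f y)) = 0 := by linear_combination -h
  rcases mul_eq_zero.mp this with h0 | h0
  · exact absurd h0 hd
  · linear_combination h0

/-- **(2.4.2)** «`Ξ_P(x, y) := (f(x), y)_V`» is ALTERNATING when `B` is symmetric (anti-self-duality of `f`):
`Ξ_P(y, x) = −Ξ_P(x, y)`. [cite: Markman2025SecantWeil, (2.4.2), v2 p. 19 L27–30 (transcription)] -/
theorem xi_antisymm (B : V →ₗ[K] V →ₗ[K] K) (hB : ∀ x y, B x y = B y x) (f : V →ₗ[K] V) (d : K) (hd : d ≠ 0)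
    (hf : ∀ x y, B (f x) (f y) = d * B x y) (hff : ∀ x, f (f x) = -(d • x)) (x y : V) :
    B (f y) x = -B (f x) y := by
  rw [hB (f y) x, anti_self_dual B f d hd hf hff x y, neg_neg]

/-- **v2 p. 19 L31–32** «The 2-form `Ξ_P` is non-degenerate, since `f` is invertible and the pairing (1.2.2) on `V` is
non-degenerate»: if `B(v, •) = 0 ⇒ v = 0`, then `Ξ_P(x, •) = 0 ⇒ x = 0` (invertibility of `f` from `f² = −d`, `d ≠ 0`:
`x = −d⁻¹·f(f x)`). [cite: Markman2025SecantWeil, (2.4.2), v2 p. 19 L31–32 (transcription)] -/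
theorem xi_nondegenerate (B : V →ₗ[K] V →ₗ[K] K) (hBnd : ∀ v, (∀ w, B v w = 0) → v = 0) (f : V →ₗ[K] V) (d : K)
    (hd : d ≠ 0) (hff : ∀ x, f (f x) = -(d • x)) (x : V) (hx : ∀ y, B (f x) y = 0) : x = 0 := by
  have hfx : f x = 0 := hBnd (f x) hx
  have h := hff x
  rw [hfx, map_zero] at h
  -- h : 0 = -(d • x)
  have h2 : d • x = 0 := by
    have := congrArg Neg.neg h
    simpa using this.symm
  rcases smul_eq_zero.mp h2 with h0 | h0
  · exact absurd h0 hd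
  · exact h0

/-- **v2 p. 19 L32–36** «`Ξ_P(x, y) = √−d((x₁, y₂)_V − (x₂, y₁)_V)`, where `x = x₁ + x₂` … `xᵢ ∈ Wᵢ`»: with `f = s` on
`W₁`, `f = −s` on `W₂` (`s = √−d`; (2.4.6)) and `W₁`, `W₂` isotropic for `B` (Lemma 2.2.6), for the four components.
[cite: Markman2025SecantWeil, (2.4.2), v2 p. 19 L32–36 (transcription)] -/
theorem xi_decomposition (B : V →ₗ[K] V →ₗ[K] K) (f : V →ₗ[K] V) (s : K) (x₁ x₂ y₁ y₂ : V)
    (h1x : f x₁ = s • x₁) (h2x : f x₂ = -(s • x₂)) (hiso1 : B x₁ y₁ = 0) (hiso2 : B x₂ y₂ = 0) :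
    B (f (x₁ + x₂)) (y₁ + y₂) = s * (B x₁ y₂ - B x₂ y₁) := by
  rw [f.map_add, h1x, h2x]
  simp only [map_add, map_neg, map_smul, LinearMap.add_apply, LinearMap.neg_apply, LinearMap.smul_apply,
    smul_eq_mul, hiso1, hiso2]
  ring

end WeilFormXi

end Literature.AlgebraicGeometry.Markman2025
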